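import Summits.HubbardSuperconductivity.HubbardSuperconductivity.Theorems.SoloBlindVariationalCrutch
import Literature.MathematicalPhysics.QuantumLattice.HubbardModelThermodynamicLimitProofs
import Literature.MathematicalPhysics.QuantumLattice.HubbardModelParticleHoleProofs
import Literature.MathematicalPhysics.QuantumLattice.HubbardLSMFillingProofs
import Literature.MathematicalPhysics.QuantumLattice.ProjectedBCSState
import HarnessLib

/-!
# Holes, doublons and hopping in the occupation basis (Theorem 34, part 1/3)

Solo-blind programme `HubbardSuperconductivity`, generation 29.  Elementary bookkeeping for the
strong-coupling (Mott) lower bound on the Hubbard energy (`SoloBlindMottFloor`):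

* `norm_hop_le` — in the occupation-number basis a hopping expectation is controlled by the
  overlap of the amplitudes of the two configurations it connects,
  `|⟨ψ, c†_a c_b ψ⟩| ≤ Σ_u [a ∉ u][b ∉ u] |ψ(u ∪ a)| |ψ(u ∪ b)|`;
* `sum_ite_insert` — re-indexing such sums by the occupied configuration;
* `mul_le_cA_cB` — the weighted AM–GM inequality with the type-dependent weights `cA`, `cB`
  (`½/½` for hole or doublon motion, `α/β` with `4αβ = 1` when a doublon is created or destroyed);
* `holeCount`, the tree's `doublonCount` (`ProjectedBCSState`; `doublonCount_eq_card_isDbl`) and the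
  site identity `#holes + #electrons = L² + #doublons`;
* the degree bound `≤ 4` of the square torus and the resulting row/column sums;
* `re_expect_doublon` — `⟨ψ, Σ_x n_{x↑} n_{x↓} ψ⟩ = Σ_s D(s) |ψ(s)|²`, and the hole count in an
  `N`-particle sector.

All statements are finite-dimensional and elementary. [this work; folklore]
-/

noncomputable section

namespace Summit.HubbardSuperconductivity.HubbardSuperconductivity.Theorems.MottFloor

open Matrix Finset Literature.Probability.LatticeModels Literature.MathematicalPhysics.QuantumLattice
  Literature.MathematicalPhysics.QuantumLattice.EigenvalueContinuation
open scoped ComplexOrder ComplexConjugate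

/-! ### Generic occupation-basis bounds -/

section Generic

variable {ι : Type*} [LinearOrder ι] [Fintype ι]

/-- **Hopping in the occupation basis**: `|⟨ψ, c†_a c_b ψ⟩| ≤ Σ_u [a ∉ u] [b ∉ u] |ψ(u ∪ a)| |ψ(u ∪ b)|`
(`⟨ψ, c†_a c_b ψ⟩ = ⟨c_a ψ, c_b ψ⟩` and `(c_b ψ)(u) = ± ψ(u ∪ b)`). [folklore] -/
theorem norm_hop_le (a b : ι) (ψ : Fock ι) :
    ‖star ψ ⬝ᵥ ((creation a * annihilation b) *ᵥ ψ)‖ ≤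
      ∑ u, if a ∉ u ∧ b ∉ u then ‖ψ (insert a u)‖ * ‖ψ (insert b u)‖ else 0 := by
  rw [ThermodynamicLimit.dotProduct_creation_mul_annihilation_mulVec, dotProduct]
  refine (norm_sum_le _ _).trans (Finset.sum_le_sum fun u _ => ?_)
  rw [Pi.star_apply, annihilation_mulVec_apply, annihilation_mulVec_apply]
  by_cases ha : a ∉ u
  · by_cases hb : b ∉ u
    · rw [if_pos ha, if_pos hb, if_pos ⟨ha, hb⟩, star_mul', norm_mul, norm_mul, norm_mul,
        norm_star, norm_star, norm_jwSign, norm_jwSign, one_mul, one_mul]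
    · simp [hb]
  · simp [ha]

/-- Re-indexing a sum over configurations `u ∌ a` by `s = u ∪ {a}`. [folklore] -/
theorem sum_ite_insert (a : ι) (P : Finset ι → Prop) [DecidablePred P] (f : Finset ι → ℝ) :
    (∑ u, if a ∉ u ∧ P u then f (insert a u) else 0) =
      ∑ s, if a ∈ s ∧ P (s.erase a) then f s else 0 := by
  rw [← Finset.sum_filter, ← Finset.sum_filter]
  refine Finset.sum_nbij' (fun u => insert a u) (fun s => s.erase a) ?_ ?_ ?_ ?_ ?_
  · intro u hu
    simp only [Finset.mem_filter, Finset.mem_univ, true_and] at hu ⊢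
    exact ⟨Finset.mem_insert_self a u, by rw [Finset.erase_insert hu.1]; exact hu.2⟩
  · intro s hs
    simp only [Finset.mem_filter, Finset.mem_univ, true_and] at hs ⊢
    exact ⟨Finset.notMem_erase a s, hs.2⟩
  · intro u hu
    simp only [Finset.mem_filter, Finset.mem_univ, true_and] at hu
    exact Finset.erase_insert hu.1
  · intro s hs
    simp only [Finset.mem_filter, Finset.mem_univ, true_and] at hs
    exact Finset.insert_erase hs.1
  · intro u _; rfl

omit [LinearOrder ι] in
/-- `re ⟨ψ, ψ⟩ = Σ_s |ψ(s)|²`. [folklore] -/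
theorem re_star_dotProduct_self_eq (ψ : Fock ι) :
    (star ψ ⬝ᵥ ψ).re = ∑ s, ‖ψ s‖ ^ 2 := by
  rw [dotProduct, Complex.re_sum]
  refine Finset.sum_congr rfl fun s _ => ?_
  rw [Pi.star_apply, Complex.star_def, Complex.conj_mul', ← Complex.ofReal_pow, Complex.ofReal_re]

end Generic

/-! ### Weighted AM–GM with type-dependent weights -/

/-- Weight on the `a`-side configuration: `½` (hole motion / doublon motion), `α` (doublon
created at `x`), `β` (doublon created at `y`). -/
def cA (α β : ℝ) : Bool → Bool → ℝ
  | true, true => 1 / 2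
  | true, false => α
  | false, true => β
  | false, false => 1 / 2

/-- Weight on the `b`-side configuration (mirror of `cA`). -/
def cB (α β : ℝ) : Bool → Bool → ℝ
  | true, true => 1 / 2
  | true, false => β
  | false, true => α
  | false, false => 1 / 2

/-- `AB ≤ c_A A² + c_B B²` for each weight pair (`½,½`), (`α,β`), (`β,α`) with `4αβ = 1`. [folklore] -/
theorem mul_le_cA_cB {α β : ℝ} (hα : 0 < α) (hαβ : 4 * α * β = 1) (p q : Bool) (A B : ℝ) :
    A * B ≤ cA α β p q * A ^ 2 + cB α β p q * B ^ 2 := by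
  have hβ : β = 1 / (4 * α) := by
    field_simp; linarith
  have h1 : A * B ≤ 1 / 2 * A ^ 2 + 1 / 2 * B ^ 2 := by nlinarith [sq_nonneg (A - B)]
  have h2 : A * B ≤ α * A ^ 2 + β * B ^ 2 := by
    have e : α * A ^ 2 + β * B ^ 2 - A * B = (2 * α * A - B) ^ 2 / (4 * α) := by
      rw [hβ]; field_simp; ring
    have : 0 ≤ (2 * α * A - B) ^ 2 / (4 * α) := by positivity
    linarith
  have h3 : A * B ≤ β * A ^ 2 + α * B ^ 2 := by
    have e : β * A ^ 2 + α * B ^ 2 - A * B = (2 * α * B - A) ^ 2 / (4 * α) := by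
      rw [hβ]; field_simp; ring
    have : 0 ≤ (2 * α * B - A) ^ 2 / (4 * α) := by positivity
    linarith
  cases p <;> cases q <;> simp only [cA, cB] <;> assumption

/-! ### The square torus: sites, holes, doublons -/

variable {L : ℕ} [NeZero L]

/-- Pin `DecidableEq` on orbitals to the order-derived instance used by the orbital-generic
fermion lemmas (avoids instance-unification blow-ups in `if _ ∈ _` terms). [folklore] -/
local instance (priority := high) instDecidableEqOrbTorusMott :
    DecidableEq (Orb (FermionTorus 2 L)) := LinearOrder.toDecidableEq

/-- Pin `DecidableEq` on sites likewise. [folklore] -/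
local instance (priority := high) instDecidableEqTorusMott :
    DecidableEq (FermionTorus 2 L) := LinearOrder.toDecidableEq

/-- Site `x` is empty in the configuration `s`. -/
abbrev IsEmp (s : Finset (Orb (FermionTorus 2 L))) (x : FermionTorus 2 L) : Prop :=
  orb x 0 ∉ s ∧ orb x 1 ∉ s

/-- Site `x` is doubly occupied in the configuration `s`. -/
abbrev IsDbl (s : Finset (Orb (FermionTorus 2 L))) (x : FermionTorus 2 L) : Prop :=
  orb x 0 ∈ s ∧ orb x 1 ∈ s

/-- `IsEmp s` is decidable. -/
instance instDecidablePredIsEmp (s : Finset (Orb (FermionTorus 2 L))) :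
    DecidablePred (IsEmp s) :=
  fun x => inferInstanceAs (Decidable (orb x 0 ∉ s ∧ orb x 1 ∉ s))

/-- `IsDbl s` is decidable. -/
instance instDecidablePredIsDbl (s : Finset (Orb (FermionTorus 2 L))) :
    DecidablePred (IsDbl s) :=
  fun x => inferInstanceAs (Decidable (orb x 0 ∈ s ∧ orb x 1 ∈ s))

/-- Number of empty sites (holes) of a configuration. -/
def holeCount (s : Finset (Orb (FermionTorus 2 L))) : ℕ := (univ.filter (IsEmp s)).card

omit [NeZero L] in
/-- The tree's doublon number `doublonCount` (`ProjectedBCSState`) counted with the local predicate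
`IsDbl`: `D(s) = #{x | IsDbl s x}`. [folklore] -/
theorem doublonCount_eq_card_isDbl (s : Finset (Orb (FermionTorus 2 L))) :
    doublonCount s = (univ.filter (IsDbl s)).card := by
  rw [doublonCount_eq_card_filter]

omit [NeZero L] in
/-- `|Λ| = L²` for the fermionic square torus (file-local copy of a folklore fact). -/
private theorem card_fermionTorus : Fintype.card (FermionTorus 2 L) = L ^ 2 := by
  simp [FermionTorus, Fintype.card_lex]

omit [NeZero L] in
/-- A sum over orbitals is a sum over sites and spins. [folklore] -/
theorem sum_orb (g : Orb (FermionTorus 2 L) → ℕ) :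
    ∑ o, g o = ∑ x : FermionTorus 2 L, (g (orb x 0) + g (orb x 1)) := by
  rw [← Equiv.sum_comp (toLex : FermionTorus 2 L × Fin 2 ≃ Orb (FermionTorus 2 L)),
    Fintype.sum_prod_type]
  refine Finset.sum_congr rfl fun x _ => ?_
  rw [Fin.sum_univ_two]

omit [NeZero L] in
/-- **Site bookkeeping**: `#holes + #electrons = L² + #doublons`. [folklore] -/
theorem holeCount_add_card (s : Finset (Orb (FermionTorus 2 L))) :
    holeCount s + s.card = L ^ 2 + doublonCount s := by
  have hcard : s.card = ∑ x : FermionTorus 2 L,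
      ((if orb x 0 ∈ s then 1 else 0) + (if orb x 1 ∈ s then 1 else 0)) := by
    rw [← sum_orb (fun o => if o ∈ s then 1 else 0), Finset.sum_boole, Finset.filter_mem_eq_inter,
      Finset.univ_inter]; rfl
  have hL : L ^ 2 = ∑ x : FermionTorus 2 L, 1 := by
    rw [Finset.sum_const, smul_eq_mul, mul_one, Finset.card_univ, card_fermionTorus]
  rw [holeCount, doublonCount_eq_card_isDbl, Finset.card_filter, Finset.card_filter, hcard, hL,
    ← Finset.sum_add_distrib, ← Finset.sum_add_distrib]
  refine Finset.sum_congr rfl fun x _ => ?_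
  by_cases h0 : orb x 0 ∈ s <;> by_cases h1 : orb x 1 ∈ s <;> simp [IsEmp, IsDbl, h0, h1]

/-- The neighbours of a site of the square torus number at most four. [folklore] -/
theorem card_filter_adj_le (x : FermionTorus 2 L) :
    (univ.filter fun y => (fermionTorusGraph 2 L).Adj x y).card ≤ 4 := by
  classical
  let g : Fin 2 × Bool → FermionTorus 2 L := fun p =>
    FermionTorus.ofTorusSite (x.toTorusSite + (if p.2 then Pi.single p.1 1 else -Pi.single p.1 1))
  have hsub : (univ.filter fun y => (fermionTorusGraph 2 L).Adj x y) ⊆ univ.image g := by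
    intro y hy
    rw [Finset.mem_filter] at hy
    rw [Finset.mem_image]
    rcases (torusGraph_adj_iff _ _).1 ((fermionTorusGraph_adj x y).1 hy.2) with ⟨-, ⟨i, hi⟩ | ⟨i, hi⟩⟩
    · refine ⟨(i, true), Finset.mem_univ _, ?_⟩
      simp only [g, if_true, ← hi, FermionTorus.ofTorusSite_toTorusSite]
    · refine ⟨(i, false), Finset.mem_univ _, ?_⟩
      have : y.toTorusSite = x.toTorusSite + -Pi.single i 1 := by rw [hi]; abel
      simp only [g, Bool.false_eq_true, if_false, ← this, FermionTorus.ofTorusSite_toTorusSite]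
  calc (univ.filter fun y => (fermionTorusGraph 2 L).Adj x y).card
      ≤ (univ.image g).card := Finset.card_le_card hsub
    _ ≤ (univ : Finset (Fin 2 × Bool)).card := Finset.card_image_le
    _ = 4 := by simp

/-- Row sums against the adjacency matrix: `Σ_x Σ_y [x ∼ y] f(x) ≤ 4 Σ_x f(x)`. [folklore] -/
theorem sum_adj_left_le (f : FermionTorus 2 L → ℝ) (hf : ∀ x, 0 ≤ f x) :
    ∑ x, ∑ y, (if (fermionTorusGraph 2 L).Adj x y then f x else 0) ≤ 4 * ∑ x, f x := by
  rw [Finset.mul_sum]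
  refine Finset.sum_le_sum fun x _ => ?_
  rw [← Finset.sum_filter, Finset.sum_const, nsmul_eq_mul]
  exact mul_le_mul_of_nonneg_right (by exact_mod_cast card_filter_adj_le x) (hf x)

/-- Column sums against the adjacency matrix: `Σ_x Σ_y [x ∼ y] f(y) ≤ 4 Σ_y f(y)`. [folklore] -/
theorem sum_adj_right_le (f : FermionTorus 2 L → ℝ) (hf : ∀ y, 0 ≤ f y) :
    ∑ x, ∑ y, (if (fermionTorusGraph 2 L).Adj x y then f y else 0) ≤ 4 * ∑ y, f y := by
  rw [Finset.sum_comm]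
  simp_rw [(fermionTorusGraph 2 L).adj_comm]
  exact sum_adj_left_le f hf


/-! ### Expectations in the occupation basis -/

omit [NeZero L] in
/-- `⟨ψ, Σ_x n_{x↑} n_{x↓} ψ⟩.re = Σ_s D(s) |ψ(s)|²`. [folklore] -/
theorem re_expect_doublon (ψ : Fock (Orb (FermionTorus 2 L))) :
    (star ψ ⬝ᵥ (∑ x : FermionTorus 2 L, numberOp x 0 * numberOp x 1) *ᵥ ψ).re =
      ∑ s, (doublonCount s : ℝ) * ‖ψ s‖ ^ 2 := by
  have happ : ∀ s, ((∑ x : FermionTorus 2 L, numberOp x 0 * numberOp x 1) *ᵥ ψ) s =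
      (doublonCount s : ℂ) * ψ s := by
    intro s
    rw [Matrix.sum_mulVec, Finset.sum_apply]
    simp_rw [← Matrix.mulVec_mulVec, numberOp_mulVec_apply]
    rw [doublonCount_eq_card_isDbl, Finset.card_filter]
    push_cast
    rw [Finset.sum_mul]
    refine Finset.sum_congr rfl fun x _ => ?_
    by_cases h0 : orb x 0 ∈ s <;> by_cases h1 : orb x 1 ∈ s <;> simp [IsDbl, h0, h1]
  rw [dotProduct, Complex.re_sum]
  refine Finset.sum_congr rfl fun s _ => ?_
  rw [happ, Pi.star_apply, Complex.star_def, ← mul_assoc, mul_comm (starRingEnd ℂ (ψ s)),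
    mul_assoc, Complex.conj_mul', ← Complex.ofReal_pow, ← Complex.ofReal_natCast,
    ← Complex.ofReal_mul, Complex.ofReal_re]

omit [NeZero L] in
/-- In the `N`-particle sector the hole count is `L² - N + D(s)` on the support of `ψ`. [folklore] -/
theorem sum_holeCount_eq {N : ℕ} {ψ : Fock (Orb (FermionTorus 2 L))} (hψ : IsNParticle N ψ) :
    ∑ s, (holeCount s : ℝ) * ‖ψ s‖ ^ 2 =
      ∑ s, (((L : ℝ) ^ 2 - N) + (doublonCount s : ℝ)) * ‖ψ s‖ ^ 2 := by
  refine Finset.sum_congr rfl fun s _ => ?_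
  by_cases hs : s.card = N
  · have h := holeCount_add_card s
    rw [hs] at h
    have h' : (holeCount s : ℝ) + N = (L : ℝ) ^ 2 + doublonCount s := by exact_mod_cast h
    rw [show (holeCount s : ℝ) = (L : ℝ) ^ 2 - N + doublonCount s by linarith]
  · rw [hψ s hs]; simp

omit [NeZero L] in
/-- `⟨ψ, (if p then M else 0) ψ⟩ = [p] ⟨ψ, M ψ⟩`. [folklore] -/
theorem dotProduct_ite_mulVec (p : Prop) [Decidable p]
    (M : Matrix (Finset (Orb (FermionTorus 2 L))) (Finset (Orb (FermionTorus 2 L))) ℂ)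
    (ψ : Fock (Orb (FermionTorus 2 L))) :
    star ψ ⬝ᵥ ((if p then M else 0) *ᵥ ψ) = if p then star ψ ⬝ᵥ (M *ᵥ ψ) else 0 := by
  split_ifs <;> simp

end Summit.HubbardSuperconductivity.HubbardSuperconductivity.Theorems.MottFloor
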